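import Summits.BirchSwinnertonDyer.BirchSwinnertonDyer.Theorems.ByReductionTypeAtTwoAdditivePotMultConjATwoNarrowTwo28056TotPos
import Summits.BirchSwinnertonDyer.BirchSwinnertonDyer.Theorems.ByReductionTypeAtTwoAdditivePotMultConjATwoNarrowRoadKitLayerTwo
import Summits.BirchSwinnertonDyer.BirchSwinnertonDyer.Theorems.ByReductionTypeAtTwoFineSelmerConjAAtTwoAdditivePotGoodNarrowRankCertificate316LayerTwo
import HarnessLib

/-!
# C4″ `AdditivePotMultOverKAtTwo` (item stmt-BirchSwinnertonDyer-22618), the (I1M′) input of the upper half on the `0 < Δ` rows: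
# LAYER-TWO NARROW CERTIFICATE `d = 28056` (NON-monogenic cubic field), part INTEGERS — the integers `θ, γ, ω, p = e/η` of `A₂ = ℚ(θ) ⊔ ℚ_2 = ℚ(θ, √(2+√2))`
# (`𝓞 A₂ = 𝓞_E[ω] ⊕ 𝓞_E[ω]·p`, `𝓞_E = ℤ⟨1,θ,γ⟩`) with their values and relations (KERNEL; rows 224448ck1)

Cell `bsd-2adic`, rung K4, seat `bsd-2adic-k4-w3` GEN 14 (explicit unit of director-bsd g16 (309)(7); `--supports stmt-BirchSwinnertonDyer-22618`).
HONEST FRAMING (D-0036/D-0054/D-0152): THEOREMS ONLY (no definition, no named fact, no `sorry`, no instance). The series `…NarrowTwo28056{Class, Field,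
Dyadic, Residues, TotPos, Integers, Parity, SignsA/B/C, Units, Rows}` carries k4-w1 GEN 11's zero-hypothesis LAYER-TWO narrow certificate (row `261648q1`,
`…NarrowRankCertificate316*`: `h(A₁)`, `h(A₂)` odd by genus theory with one dyadic non-norm unit, ONE totally positive non-square unit of `A₁ = ℚ(θ,√2)`,
ELEVEN sign-independent units of `A₂ = ℚ(θ,√(2+√2))`, k4-w2's Edgar–Mollin–Peterson door `a = 1, b = 11`, cruxlead-19573-w2's rung `m = 1`) to the
totally real cubic `2`-torsion field of discriminant `28056` (`X³ + (-29)X² + (210)X + (-18)`) of the C4″ census rows 224448ck1 (eng-2 CERT-ADD-POTMULT-POS81-AB-E2: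
`n₀ = 0`, `rank₂ Cl⁺ = [0,1,1]`, unit signature ranks `[3,5,11]`, `h = 1` at layers `0,1,2` — letter NARROW-EQUAL12, instrument grade `grh`; here KERNEL).
All certificates were found by the seat's exact-arithmetic tools (`k4w3/gen13/tools`: GEN 12 `narrowcert/unitlib` + layer-two arithmetic `nf12/cert2`) and are CHECKED
HERE by the kernel. Statement (A) is NOT BSD: BSD₂ for these curves is not proved; C4″ / (I1M′) stay research-open; nothing booked; no row of 22618 changes tier
(pen RC-490 (4)); BSD is not proved by any of this.

References: [CoatesSujatha2005] Conj. A, Thm. 3.4; [Fukuda1994] Thm. 1 (2); [EdgarMollinPeterson1986] Thm. 2.1; [FrohlichTaylor1990] Ch. V §1 (1.8)–(1.13);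
[Lang1990] Ch. 13 §4 Lemma 4.1; [Washington1997] §13.1, Prop. 13.2; [Cohen1993] §4.1.3, §6.3; [Marcus1977] Ch. 5 Thm. 22, 35–37; [Omeara1963] §63.
-/

set_option autoImplicit false
-- sibling precedent: the directory name repeats the summit name
set_option linter.dupNamespace false

noncomputable section

open scoped Classical IntermediateField NumberField nonZeroDivisors Polynomial

namespace Summit.BirchSwinnertonDyer.BirchSwinnertonDyer.Theorems.AddKatoTwo

open Polynomial IsDedekindDomain NumberField Field IntermediateField
  Literature.NumberTheory.EllipticCurves Literature.NumberTheory.EllipticCurves.ZpExtension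
  Literature.NumberTheory.IwasawaTheory Literature.NumberTheory.NumberFields
  Literature.NumberTheory.GaloisRepresentations Literature.Geometry.Kaehler.ComplexTorus

variable {θ : AlgebraicClosure ℚ}

set_option linter.unusedSimpArgs false in
set_option maxHeartbeats 1600000 in
/-- **The integers `b = θ`, `γ = (θ + θ ^ 2)/3` (integral basis `1, θ, γ` of the NON-monogenic `𝓞_E`), `ω` (generator of `𝓞 A₁` over `𝓞_E`), `p = e/η` of
`A₂ = ℚ(θ) ⊔ ℚ_2`** (`θ³ + (-29)θ² + (210)θ + (-18) = 0`, `d = 28056`; `e ∈ ℚ_2` a root of `Ψ₂`, `t = e² − 2 = √2`, `η = -380 + 9 * ω - 994 * γ + 4746 * θ + 23 * γ * ω - 110 * θ * ω` the second dyadic prime of `A₁`): values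
`ω = ((θ + θ ^ 2) + t * (-15 + 48 * θ - 3 * θ ^ 2)) / 6`, `p = e·((282 - 74 * θ + 4 * θ ^ 2) + t·(186 - θ - θ ^ 2))/12`, and relations `θ² = 3 * γ - θ`, `θγ = 6 + 30 * γ - 80 * θ`, `γ² = 62 + 230 * γ - 798 * θ`,
`ω² = (γ) * ω + (-30 - 104 * γ + 459 * θ)`, `p² = -6199 - 1137 * ω - 25304 * γ + 120502 * θ + 562 * γ * ω - 2580 * θ * ω` (`𝓞 A₂ = 𝓞_E[ω] ⊕ 𝓞_E[ω]·p` by the seat's `2`-maximal-order computation — not needed);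
`γ`, `ω` integral by monic sextics, `p` as a square root of an integer. KERNEL. [cite: Cohen1993, §4.8.2 and §6.3] [cite: Washington1997, §13.1] -/
theorem layer_two_integers_d28056 (hθ : aeval θ (Cubic.toPoly ⟨1, ((-29 : ℤ) : ℚ), ((210 : ℤ) : ℚ), ((-18 : ℤ) : ℚ)⟩) = 0)
    {e : AlgebraicClosure ℚ} (he : e ∈ (CyclotomicZp.zpExtension 2).layer 2) (he0 : (fun x : AlgebraicClosure ℚ => x ^ 2 - 2)^[2] e = 0) :
    haveI : FiniteDimensional ℚ ↥ℚ⟮θ⟯ :=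
      IntermediateField.adjoin.finiteDimensional ⟨_, Cubic.monic_of_a_eq_one', by rwa [← aeval_def]⟩
    haveI : FiniteDimensional ℚ ↥((CyclotomicZp.zpExtension 2).layer 2) := (CyclotomicZp.zpExtension 2).finiteDimensional_layer_holds 2
    ∃ bB gB xB pB : 𝓞 ↥(ℚ⟮θ⟯ ⊔ (CyclotomicZp.zpExtension 2).layer 2),
      (bB : ↥(ℚ⟮θ⟯ ⊔ (CyclotomicZp.zpExtension 2).layer 2)) = inclusion (le_sup_left : ℚ⟮θ⟯ ≤ ℚ⟮θ⟯ ⊔ (CyclotomicZp.zpExtension 2).layer 2) (AdjoinSimple.gen ℚ θ) ∧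
      (gB : ↥(ℚ⟮θ⟯ ⊔ (CyclotomicZp.zpExtension 2).layer 2)) = ((inclusion (le_sup_left : ℚ⟮θ⟯ ≤ ℚ⟮θ⟯ ⊔ (CyclotomicZp.zpExtension 2).layer 2) (AdjoinSimple.gen ℚ θ) + inclusion (le_sup_left : ℚ⟮θ⟯ ≤ ℚ⟮θ⟯ ⊔ (CyclotomicZp.zpExtension 2).layer 2) (AdjoinSimple.gen ℚ θ) ^ 2) / 3) ∧
      (xB : ↥(ℚ⟮θ⟯ ⊔ (CyclotomicZp.zpExtension 2).layer 2)) = (((inclusion (le_sup_left : ℚ⟮θ⟯ ≤ ℚ⟮θ⟯ ⊔ (CyclotomicZp.zpExtension 2).layer 2) (AdjoinSimple.gen ℚ θ) + inclusion (le_sup_left : ℚ⟮θ⟯ ≤ ℚ⟮θ⟯ ⊔ (CyclotomicZp.zpExtension 2).layer 2) (AdjoinSimple.gen ℚ θ) ^ 2) + ((⟨e, (le_sup_right : (CyclotomicZp.zpExtension 2).layer 2 ≤ _) he⟩ : ↥(ℚ⟮θ⟯ ⊔ (CyclotomicZp.zpExtension 2).layer 2)) ^ 2 - 2) * (-15 +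 48 * inclusion (le_sup_left : ℚ⟮θ⟯ ≤ ℚ⟮θ⟯ ⊔ (CyclotomicZp.zpExtension 2).layer 2) (AdjoinSimple.gen ℚ θ) - 3 * inclusion (le_sup_left : ℚ⟮θ⟯ ≤ ℚ⟮θ⟯ ⊔ (CyclotomicZp.zpExtension 2).layer 2) (AdjoinSimple.gen ℚ θ) ^ 2)) / 6) ∧
      (pB : ↥(ℚ⟮θ⟯ ⊔ (CyclotomicZp.zpExtension 2).layer 2)) = ((⟨e, (le_sup_right : (CyclotomicZp.zpExtension 2).layer 2 ≤ _) he⟩ : ↥(ℚ⟮θ⟯ ⊔ (CyclotomicZp.zpExtension 2).layer 2)) * ((282 - 74 * inclusion (le_sup_left : ℚ⟮θ⟯ ≤ ℚ⟮θ⟯ ⊔ (CyclotomicZp.zpExtension 2).layer 2) (AdjoinSimple.gen ℚ θ) + 4 * inclusion (le_sup_left : ℚ⟮θ⟯ ≤ ℚ⟮θ⟯ ⊔ (CyclotomicZp.zpExtension 2).layer 2) (AdjoinSimple.gen ℚ θ) ^ 2) + ((⟨e, (le_sup_right : (CyclotomicZp.zpExtension 2).layer 2 ≤ _) he⟩ :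 ↥(ℚ⟮θ⟯ ⊔ (CyclotomicZp.zpExtension 2).layer 2)) ^ 2 - 2) * (186 - inclusion (le_sup_left : ℚ⟮θ⟯ ≤ ℚ⟮θ⟯ ⊔ (CyclotomicZp.zpExtension 2).layer 2) (AdjoinSimple.gen ℚ θ) - inclusion (le_sup_left : ℚ⟮θ⟯ ≤ ℚ⟮θ⟯ ⊔ (CyclotomicZp.zpExtension 2).layer 2) (AdjoinSimple.gen ℚ θ) ^ 2)) / 12) ∧
      bB ^ 2 = 3 * gB - bB ∧ bB * gB = 6 + 30 * gB - 80 * bB ∧ gB ^ 2 = 62 + 230 * gB - 798 * bB ∧ xB ^ 2 = (gB) * xB + (-30 - 104 * gB + 459 * bB) ∧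
      pB ^ 2 = -6199 - 1137 * xB - 25304 * gB + 120502 * bB + 562 * gB * xB - 2580 * bB * xB := by
  haveI : FiniteDimensional ℚ ↥ℚ⟮θ⟯ :=
    IntermediateField.adjoin.finiteDimensional ⟨_, Cubic.monic_of_a_eq_one', by rwa [← aeval_def]⟩
  haveI : FiniteDimensional ℚ ↥((CyclotomicZp.zpExtension 2).layer 2) := (CyclotomicZp.zpExtension 2).finiteDimensional_layer_holds 2
  haveI : NumberField ↥ℚ⟮θ⟯ := NumberField.mk
  haveI : NumberField ↥(ℚ⟮θ⟯ ⊔ (CyclotomicZp.zpExtension 2).layer 2) := NumberField.mk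
  have hKA : ℚ⟮θ⟯ ≤ ℚ⟮θ⟯ ⊔ (CyclotomicZp.zpExtension 2).layer 2 := le_sup_left
  have heA : e ∈ ℚ⟮θ⟯ ⊔ (CyclotomicZp.zpExtension 2).layer 2 := (le_sup_right : (CyclotomicZp.zpExtension 2).layer 2 ≤ _) he
  set e'' : ↥(ℚ⟮θ⟯ ⊔ (CyclotomicZp.zpExtension 2).layer 2) := ⟨e, heA⟩ with he''def
  obtain ⟨-, ht2⟩ := sq_sub_two_mem_layer_one_d316 he0
  set t'' : ↥(ℚ⟮θ⟯ ⊔ (CyclotomicZp.zpExtension 2).layer 2) := e'' ^ 2 - 2 with ht''def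
  have ht''2 : t'' ^ 2 = 2 := by
    apply (algebraMap ↥(ℚ⟮θ⟯ ⊔ (CyclotomicZp.zpExtension 2).layer 2) (AlgebraicClosure ℚ)).injective
    rw [map_pow, map_ofNat, ht''def, map_sub, map_pow, map_ofNat]
    exact ht2
  have he''2 : e'' ^ 2 = 2 + t'' := by rw [ht''def]; ring
  letI : Algebra ↥ℚ⟮θ⟯ ↥(ℚ⟮θ⟯ ⊔ (CyclotomicZp.zpExtension 2).layer 2) := (inclusion hKA).toRingHom.toAlgebra
  have halg : ∀ c : ↥ℚ⟮θ⟯, algebraMap ↥ℚ⟮θ⟯ ↥(ℚ⟮θ⟯ ⊔ (CyclotomicZp.zpExtension 2).layer 2) c = inclusion hKA c := fun _ => rfl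
  haveI : IsScalarTower ℚ ↥ℚ⟮θ⟯ ↥(ℚ⟮θ⟯ ⊔ (CyclotomicZp.zpExtension 2).layer 2) :=
    IsScalarTower.of_algebraMap_eq fun q => ((inclusion hKA).commutes q).symm
  obtain ⟨b, hbθ, hb⟩ := exists_ringOfIntegers_cubic_root (p := -29) (q := 210) (r := -18) hθ
  have hb' : -18 + 210 * b - 29 * b ^ 2 + b ^ 3 = 0 := by push_cast at hb; linear_combination hb
  have hbgen : algebraMap (𝓞 ↥ℚ⟮θ⟯) ↥ℚ⟮θ⟯ b = AdjoinSimple.gen ℚ θ := Subtype.ext hbθ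
  set θ'' : ↥(ℚ⟮θ⟯ ⊔ (CyclotomicZp.zpExtension 2).layer 2) := inclusion hKA (AdjoinSimple.gen ℚ θ) with hθ''def
  set bB : 𝓞 ↥(ℚ⟮θ⟯ ⊔ (CyclotomicZp.zpExtension 2).layer 2) :=
    algebraMap (𝓞 ↥ℚ⟮θ⟯) (𝓞 ↥(ℚ⟮θ⟯ ⊔ (CyclotomicZp.zpExtension 2).layer 2)) b with hbBdef
  have RbB3 : -18 + 210 * bB - 29 * bB ^ 2 + bB ^ 3 = 0 := by
    have h := congrArg (algebraMap (𝓞 ↥ℚ⟮θ⟯) (𝓞 ↥(ℚ⟮θ⟯ ⊔ (CyclotomicZp.zpExtension 2).layer 2))) hb'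
    simp only [map_add, map_sub, map_mul, map_pow, map_zero, map_ofNat, map_zero, map_neg, map_one] at h; exact h
  have hbBval : algebraMap (𝓞 ↥(ℚ⟮θ⟯ ⊔ (CyclotomicZp.zpExtension 2).layer 2)) ↥(ℚ⟮θ⟯ ⊔ (CyclotomicZp.zpExtension 2).layer 2) bB = θ'' := by
    rw [hbBdef, hθ''def, ← IsScalarTower.algebraMap_apply,
      IsScalarTower.algebraMap_apply (𝓞 ↥ℚ⟮θ⟯) ↥ℚ⟮θ⟯ ↥(ℚ⟮θ⟯ ⊔ (CyclotomicZp.zpExtension 2).layer 2), hbgen, halg]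
  have hθ''rel : -18 + 210 * θ'' - 29 * θ'' ^ 2 + θ'' ^ 3 = 0 := by
    have h := congrArg (algebraMap (𝓞 ↥(ℚ⟮θ⟯ ⊔ (CyclotomicZp.zpExtension 2).layer 2)) ↥(ℚ⟮θ⟯ ⊔ (CyclotomicZp.zpExtension 2).layer 2)) RbB3
    simp only [map_add, map_sub, map_mul, map_pow, map_zero, map_ofNat, map_zero, map_neg, map_one, hbBval] at h; exact h
  -- `γ`
  set γ'' : ↥(ℚ⟮θ⟯ ⊔ (CyclotomicZp.zpExtension 2).layer 2) := (θ'' + θ'' ^ 2) / 3 with hγ''def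
  have hγint : IsIntegral ℤ γ'' := by
    refine isIntegral_of_monic_sextic_eval γ'' (29584) (-1884432) (30060084) (-1643744) (33456) (-300) ?_
    rw [hγ''def]
    push_cast
    linear_combination (((-14792 : ↥(ℚ⟮θ⟯ ⊔ (CyclotomicZp.zpExtension 2).layer 2)) / 9) + ((424496 : ↥(ℚ⟮θ⟯ ⊔ (CyclotomicZp.zpExtension 2).layer 2)) / 27) * θ'' + ((956150 : ↥(ℚ⟮θ⟯ ⊔ (CyclotomicZp.zpExtension 2).layer 2)) / 27) * θ'' ^ 2 + ((4859990 : ↥(ℚ⟮θ⟯ ⊔ (CyclotomicZp.zpExtension 2).layer 2)) / 243) * θ'' ^ 3 + ((1253611 : ↥(ℚ⟮θ⟯ ⊔ (CyclotomicZp.zpExtension 2).layer 2)) / 729) * θ'' ^ 4 + ((-100279 : ↥(ℚ⟮θ⟯ ⊔ (CyclotomicZp.zpExtension 2).layer 2)) / 729) * θ'' ^ 5 + ((-14132 : ↥(ℚ⟮θ⟯ ⊔ (CyclotomicZp.zpExtension 2).layer 2)) / 729) * θ'' ^ 6 + ((-80 : ↥(ℚ⟮θ⟯ ⊔ (CyclotomicZp.zpExtension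 2).layer 2)) / 729) * θ'' ^ 7 + ((35 : ↥(ℚ⟮θ⟯ ⊔ (CyclotomicZp.zpExtension 2).layer 2)) / 729) * θ'' ^ 8 + ((1 : ↥(ℚ⟮θ⟯ ⊔ (CyclotomicZp.zpExtension 2).layer 2)) / 729) * θ'' ^ 9) * hθ''rel
  set gB : 𝓞 ↥(ℚ⟮θ⟯ ⊔ (CyclotomicZp.zpExtension 2).layer 2) := ⟨γ'', hγint⟩ with hgBdef
  have hgBval : algebraMap (𝓞 ↥(ℚ⟮θ⟯ ⊔ (CyclotomicZp.zpExtension 2).layer 2)) ↥(ℚ⟮θ⟯ ⊔ (CyclotomicZp.zpExtension 2).layer 2) gB = γ'' := rfl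
  have RbB : bB ^ 2 = 3 * gB - bB := by
    apply NumberField.RingOfIntegers.coe_injective
    simp only [map_add, map_sub, map_mul, map_pow, map_zero, map_ofNat, map_neg, map_one, hgBval, hbBval]
    rw [hγ''def]
    linear_combination ((0 : ↥(ℚ⟮θ⟯ ⊔ (CyclotomicZp.zpExtension 2).layer 2))) * hθ''rel
  have RbgB : bB * gB = 6 + 30 * gB - 80 * bB := by
    apply NumberField.RingOfIntegers.coe_injective
    simp only [map_add, map_sub, map_mul, map_pow, map_zero, map_ofNat, map_neg, map_one, hgBval, hbBval]
    rw [hγ''def]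
    linear_combination (((1 : ↥(ℚ⟮θ⟯ ⊔ (CyclotomicZp.zpExtension 2).layer 2)) / 3)) * hθ''rel
  have RgB : gB ^ 2 = 62 + 230 * gB - 798 * bB := by
    apply NumberField.RingOfIntegers.coe_injective
    simp only [map_add, map_sub, map_mul, map_pow, map_zero, map_ofNat, map_neg, map_one, hgBval, hbBval]
    rw [hγ''def]
    linear_combination (((31 : ↥(ℚ⟮θ⟯ ⊔ (CyclotomicZp.zpExtension 2).layer 2)) / 9) + ((1 : ↥(ℚ⟮θ⟯ ⊔ (CyclotomicZp.zpExtension 2).layer 2)) / 9) * θ'') * hθ''rel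
  -- `ω`
  set ξ'' : ↥(ℚ⟮θ⟯ ⊔ (CyclotomicZp.zpExtension 2).layer 2) := ((θ'' + θ'' ^ 2) + t'' * (-15 + 48 * θ'' - 3 * θ'' ^ 2)) / 6 with hξ''def
  have hξsq : ξ'' ^ 2 = (((1 : ↥(ℚ⟮θ⟯ ⊔ (CyclotomicZp.zpExtension 2).layer 2)) / 3) * θ'' + ((1 : ↥(ℚ⟮θ⟯ ⊔ (CyclotomicZp.zpExtension 2).layer 2)) / 3) * θ'' ^ 2) * ξ'' + ((-30 : ↥(ℚ⟮θ⟯ ⊔ (CyclotomicZp.zpExtension 2).layer 2)) + ((1273 : ↥(ℚ⟮θ⟯ ⊔ (CyclotomicZp.zpExtension 2).layer 2)) / 3) * θ'' + ((-104 : ↥(ℚ⟮θ⟯ ⊔ (CyclotomicZp.zpExtension 2).layer 2)) / 3) * θ'' ^ 2) := by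
    rw [hξ''def]
    linear_combination (((25 : ↥(ℚ⟮θ⟯ ⊔ (CyclotomicZp.zpExtension 2).layer 2)) / 4) + (-40 : ↥(ℚ⟮θ⟯ ⊔ (CyclotomicZp.zpExtension 2).layer 2)) * θ'' + ((133 : ↥(ℚ⟮θ⟯ ⊔ (CyclotomicZp.zpExtension 2).layer 2)) / 2) * θ'' ^ 2 + (-8 : ↥(ℚ⟮θ⟯ ⊔ (CyclotomicZp.zpExtension 2).layer 2)) * θ'' ^ 3 + ((1 : ↥(ℚ⟮θ⟯ ⊔ (CyclotomicZp.zpExtension 2).layer 2)) / 4) * θ'' ^ 4) * ht''2 + (((-85 : ↥(ℚ⟮θ⟯ ⊔ (CyclotomicZp.zpExtension 2).layer 2)) / 36) + ((17 : ↥(ℚ⟮θ⟯ ⊔ (CyclotomicZp.zpExtension 2).layer 2)) / 36) * θ'') * hθ''rel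
  have hξint : IsIntegral ℤ ξ'' := by
    refine isIntegral_of_monic_sextic_eval ξ'' (-6031774) (1029336) (874452) (-160828) (7857) (-150) ?_
    rw [hξ''def]
    push_cast
    linear_combination (((140470031119 : ↥(ℚ⟮θ⟯ ⊔ (CyclotomicZp.zpExtension 2).layer 2)) / 16) + ((-709260125 : ↥(ℚ⟮θ⟯ ⊔ (CyclotomicZp.zpExtension 2).layer 2)) / 4) * t'' + ((-1739657633877 : ↥(ℚ⟮θ⟯ ⊔ (CyclotomicZp.zpExtension 2).layer 2)) / 16) * θ'' + ((-179883125 : ↥(ℚ⟮θ⟯ ⊔ (CyclotomicZp.zpExtension 2).layer 2)) / 32) * t'' ^ 2 + ((38137347175 : ↥(ℚ⟮θ⟯ ⊔ (CyclotomicZp.zpExtension 2).layer 2)) / 16) * θ'' * t'' + ((8681147587919 : ↥(ℚ⟮θ⟯ ⊔ (CyclotomicZp.zpExtension 2).layer 2)) / 96) * θ'' ^ 2 + ((234375 : ↥(ℚ⟮θ⟯ ⊔ (CyclotomicZp.zpExtension 2).layer 2)) / 16) * t'' ^ 3 + ((641082125 : ↥(ℚ⟮θ⟯ ⊔ (CyclotomicZp.zpExtension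 2).layer 2)) / 8) * θ'' * t'' ^ 2 + ((-24432412985 : ↥(ℚ⟮θ⟯ ⊔ (CyclotomicZp.zpExtension 2).layer 2)) / 6) * θ'' ^ 2 * t'' + ((-11110414066409 : ↥(ℚ⟮θ⟯ ⊔ (CyclotomicZp.zpExtension 2).layer 2)) / 288) * θ'' ^ 3 + ((15625 : ↥(ℚ⟮θ⟯ ⊔ (CyclotomicZp.zpExtension 2).layer 2)) / 64) * t'' ^ 4 + ((-7503125 : ↥(ℚ⟮θ⟯ ⊔ (CyclotomicZp.zpExtension 2).layer 2)) / 32) * θ'' * t'' ^ 3 + ((-35611405015 : ↥(ℚ⟮θ⟯ ⊔ (CyclotomicZp.zpExtension 2).layer 2)) / 192) * θ'' ^ 2 * t'' ^ 2 + ((182057889793 : ↥(ℚ⟮θ⟯ ⊔ (CyclotomicZp.zpExtension 2).layer 2)) / 54) * θ'' ^ 3 * t'' + ((16587880690853 : ↥(ℚ⟮θ⟯ ⊔ (CyclotomicZp.zpExtension 2).layer 2)) / 1728) * θ'' ^ 4 + ((-9375 : ↥(ℚ⟮θ⟯ ⊔ (CyclotomicZp.zpExtension 2).layer 2)) / 2)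 * θ'' * t'' ^ 4 + ((48515625 : ↥(ℚ⟮θ⟯ ⊔ (CyclotomicZp.zpExtension 2).layer 2)) / 32) * θ'' ^ 2 * t'' ^ 3 + ((3904513029 : ↥(ℚ⟮θ⟯ ⊔ (CyclotomicZp.zpExtension 2).layer 2)) / 16) * θ'' ^ 3 * t'' ^ 2 + ((-159454238207 : ↥(ℚ⟮θ⟯ ⊔ (CyclotomicZp.zpExtension 2).layer 2)) / 144) * θ'' ^ 4 * t'' + ((-35204710769 : ↥(ℚ⟮θ⟯ ⊔ (CyclotomicZp.zpExtension 2).layer 2)) / 24) * θ'' ^ 5 + ((1209375 : ↥(ℚ⟮θ⟯ ⊔ (CyclotomicZp.zpExtension 2).layer 2)) / 32) * θ'' ^ 2 * t'' ^ 4 + ((-159873125 : ↥(ℚ⟮θ⟯ ⊔ (CyclotomicZp.zpExtension 2).layer 2)) / 32) * θ'' ^ 3 * t'' ^ 3 + ((-33919599839 : ↥(ℚ⟮θ⟯ ⊔ (CyclotomicZp.zpExtension 2).layer 2)) / 192) * θ'' ^ 4 * t'' ^ 2 + ((1528595861 : ↥(ℚ⟮θ⟯ ⊔ (CyclotomicZp.zpExtension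 2).layer 2)) / 9) * θ'' ^ 5 * t'' + ((60702456161 : ↥(ℚ⟮θ⟯ ⊔ (CyclotomicZp.zpExtension 2).layer 2)) / 432) * θ'' ^ 6 + ((-329375 : ↥(ℚ⟮θ⟯ ⊔ (CyclotomicZp.zpExtension 2).layer 2)) / 2) * θ'' ^ 3 * t'' ^ 4 + ((275488375 : ↥(ℚ⟮θ⟯ ⊔ (CyclotomicZp.zpExtension 2).layer 2)) / 32) * θ'' ^ 4 * t'' ^ 3 + ((1060317889 : ↥(ℚ⟮θ⟯ ⊔ (CyclotomicZp.zpExtension 2).layer 2)) / 16) * θ'' ^ 5 * t'' ^ 2 + ((-2346391405 : ↥(ℚ⟮θ⟯ ⊔ (CyclotomicZp.zpExtension 2).layer 2)) / 216) * θ'' ^ 6 * t'' + ((-3578997331 : ↥(ℚ⟮θ⟯ ⊔ (CyclotomicZp.zpExtension 2).layer 2)) / 432) * θ'' ^ 7 + ((26505375 : ↥(ℚ⟮θ⟯ ⊔ (CyclotomicZp.zpExtension 2).layer 2)) / 64) * θ'' ^ 4 * t'' ^ 4 + ((-110647025 : ↥(ℚ⟮θ⟯ ⊔ (CyclotomicZp.zpExtension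 2).layer 2)) / 16) * θ'' ^ 5 * t'' ^ 3 + ((-1303396285 : ↥(ℚ⟮θ⟯ ⊔ (CyclotomicZp.zpExtension 2).layer 2)) / 96) * θ'' ^ 6 * t'' ^ 2 + ((-2150852 : ↥(ℚ⟮θ⟯ ⊔ (CyclotomicZp.zpExtension 2).layer 2)) / 9) * θ'' ^ 7 * t'' + ((236645513 : ↥(ℚ⟮θ⟯ ⊔ (CyclotomicZp.zpExtension 2).layer 2)) / 864) * θ'' ^ 8 + (-589395 : ↥(ℚ⟮θ⟯ ⊔ (CyclotomicZp.zpExtension 2).layer 2)) * θ'' ^ 5 * t'' ^ 4 + ((27294013 : ↥(ℚ⟮θ⟯ ⊔ (CyclotomicZp.zpExtension 2).layer 2)) / 16) * θ'' ^ 6 * t'' ^ 3 + ((154538267 : ↥(ℚ⟮θ⟯ ⊔ (CyclotomicZp.zpExtension 2).layer 2)) / 96) * θ'' ^ 7 * t'' ^ 2 + ((12199459 : ↥(ℚ⟮θ⟯ ⊔ (CyclotomicZp.zpExtension 2).layer 2)) / 144) * θ'' ^ 8 * t'' + ((-2912119 : ↥(ℚ⟮θ⟯ ⊔ (CyclotomicZp.zpExtension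 2).layer 2)) / 864) * θ'' ^ 9 + ((6796529 : ↥(ℚ⟮θ⟯ ⊔ (CyclotomicZp.zpExtension 2).layer 2)) / 16) * θ'' ^ 6 * t'' ^ 4 + ((-2640077 : ↥(ℚ⟮θ⟯ ⊔ (CyclotomicZp.zpExtension 2).layer 2)) / 16) * θ'' ^ 7 * t'' ^ 3 + ((-10731197 : ↥(ℚ⟮θ⟯ ⊔ (CyclotomicZp.zpExtension 2).layer 2)) / 96) * θ'' ^ 8 * t'' ^ 2 + ((-794677 : ↥(ℚ⟮θ⟯ ⊔ (CyclotomicZp.zpExtension 2).layer 2)) / 144) * θ'' ^ 9 * t'' + ((-7681 : ↥(ℚ⟮θ⟯ ⊔ (CyclotomicZp.zpExtension 2).layer 2)) / 144) * θ'' ^ 10 + (-117879 : ↥(ℚ⟮θ⟯ ⊔ (CyclotomicZp.zpExtension 2).layer 2)) * θ'' ^ 7 * t'' ^ 4 + ((15995 : ↥(ℚ⟮θ⟯ ⊔ (CyclotomicZp.zpExtension 2).layer 2)) / 8) * θ'' ^ 8 * t'' ^ 3 + ((204367 : ↥(ℚ⟮θ⟯ ⊔ (CyclotomicZp.zpExtension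 2).layer 2)) / 48) * θ'' ^ 9 * t'' ^ 2 + ((22189 : ↥(ℚ⟮θ⟯ ⊔ (CyclotomicZp.zpExtension 2).layer 2)) / 144) * θ'' ^ 10 * t'' + ((1235 : ↥(ℚ⟮θ⟯ ⊔ (CyclotomicZp.zpExtension 2).layer 2)) / 864) * θ'' ^ 11 + ((1060215 : ↥(ℚ⟮θ⟯ ⊔ (CyclotomicZp.zpExtension 2).layer 2)) / 64) * θ'' ^ 8 * t'' ^ 4 + ((27975 : ↥(ℚ⟮θ⟯ ⊔ (CyclotomicZp.zpExtension 2).layer 2)) / 32) * θ'' ^ 9 * t'' ^ 3 + ((-12319 : ↥(ℚ⟮θ⟯ ⊔ (CyclotomicZp.zpExtension 2).layer 2)) / 192) * θ'' ^ 10 * t'' ^ 2 + ((-31 : ↥(ℚ⟮θ⟯ ⊔ (CyclotomicZp.zpExtension 2).layer 2)) / 24) * θ'' ^ 11 * t'' + ((5 : ↥(ℚ⟮θ⟯ ⊔ (CyclotomicZp.zpExtension 2).layer 2)) / 1728) * θ'' ^ 12 + ((-2635 : ↥(ℚ⟮θ⟯ ⊔ (CyclotomicZp.zpExtension 2).layer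 2)) / 2) * θ'' ^ 9 * t'' ^ 4 + ((-2355 : ↥(ℚ⟮θ⟯ ⊔ (CyclotomicZp.zpExtension 2).layer 2)) / 32) * θ'' ^ 10 * t'' ^ 3 + ((-17 : ↥(ℚ⟮θ⟯ ⊔ (CyclotomicZp.zpExtension 2).layer 2)) / 24) * θ'' ^ 11 * t'' ^ 2 + ((-5 : ↥(ℚ⟮θ⟯ ⊔ (CyclotomicZp.zpExtension 2).layer 2)) / 432) * θ'' ^ 12 * t'' + ((1935 : ↥(ℚ⟮θ⟯ ⊔ (CyclotomicZp.zpExtension 2).layer 2)) / 32) * θ'' ^ 10 * t'' ^ 4 + ((79 : ↥(ℚ⟮θ⟯ ⊔ (CyclotomicZp.zpExtension 2).layer 2)) / 32) * θ'' ^ 11 * t'' ^ 3 + ((5 : ↥(ℚ⟮θ⟯ ⊔ (CyclotomicZp.zpExtension 2).layer 2)) / 192) * θ'' ^ 12 * t'' ^ 2 + ((-3 : ↥(ℚ⟮θ⟯ ⊔ (CyclotomicZp.zpExtension 2).layer 2)) / 2) * θ'' ^ 11 * t'' ^ 4 + ((-1 : ↥(ℚ⟮θ⟯ ⊔ (CyclotomicZp.zpExtension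 2).layer 2)) / 32) * θ'' ^ 12 * t'' ^ 3 + ((1 : ↥(ℚ⟮θ⟯ ⊔ (CyclotomicZp.zpExtension 2).layer 2)) / 64) * θ'' ^ 12 * t'' ^ 4) * ht''2 + (((-140421776927 : ↥(ℚ⟮θ⟯ ⊔ (CyclotomicZp.zpExtension 2).layer 2)) / 144) + ((714406805 : ↥(ℚ⟮θ⟯ ⊔ (CyclotomicZp.zpExtension 2).layer 2)) / 36) * t'' + ((152103295921 : ↥(ℚ⟮θ⟯ ⊔ (CyclotomicZp.zpExtension 2).layer 2)) / 216) * θ'' + ((3904513029 : ↥(ℚ⟮θ⟯ ⊔ (CyclotomicZp.zpExtension 2).layer 2)) / 8) * t'' ^ 2 + ((-14575232297 : ↥(ℚ⟮θ⟯ ⊔ (CyclotomicZp.zpExtension 2).layer 2)) / 432) * θ'' * t'' + ((-112796334301 : ↥(ℚ⟮θ⟯ ⊔ (CyclotomicZp.zpExtension 2).layer 2)) / 432) * θ'' ^ 2 + ((-159873125 : ↥(ℚ⟮θ⟯ ⊔ (CyclotomicZp.zpExtension 2).layer 2)) / 16) * t'' ^ 3 + ((-33919599839 : ↥(ℚ⟮θ⟯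 ⊔ (CyclotomicZp.zpExtension 2).layer 2)) / 96) * θ'' * t'' ^ 2 + ((11576134189 : ↥(ℚ⟮θ⟯ ⊔ (CyclotomicZp.zpExtension 2).layer 2)) / 432) * θ'' ^ 2 * t'' + ((200367418313 : ↥(ℚ⟮θ⟯ ⊔ (CyclotomicZp.zpExtension 2).layer 2)) / 3888) * θ'' ^ 3 + (-329375 : ↥(ℚ⟮θ⟯ ⊔ (CyclotomicZp.zpExtension 2).layer 2)) * t'' ^ 4 + ((275488375 : ↥(ℚ⟮θ⟯ ⊔ (CyclotomicZp.zpExtension 2).layer 2)) / 16) * θ'' * t'' ^ 3 + ((1060317889 : ↥(ℚ⟮θ⟯ ⊔ (CyclotomicZp.zpExtension 2).layer 2)) / 8) * θ'' ^ 2 * t'' ^ 2 + ((-17203440107 : ↥(ℚ⟮θ⟯ ⊔ (CyclotomicZp.zpExtension 2).layer 2)) / 2592) * θ'' ^ 3 * t'' + ((-260458975763 : ↥(ℚ⟮θ⟯ ⊔ (CyclotomicZp.zpExtension 2).layer 2)) / 46656) * θ'' ^ 4 + ((26505375 : ↥(ℚ⟮θ⟯ ⊔ (CyclotomicZp.zpExtension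 2).layer 2)) / 32) * θ'' * t'' ^ 4 + ((-110647025 : ↥(ℚ⟮θ⟯ ⊔ (CyclotomicZp.zpExtension 2).layer 2)) / 8) * θ'' ^ 2 * t'' ^ 3 + ((-1303396285 : ↥(ℚ⟮θ⟯ ⊔ (CyclotomicZp.zpExtension 2).layer 2)) / 48) * θ'' ^ 3 * t'' ^ 2 + ((743349619 : ↥(ℚ⟮θ⟯ ⊔ (CyclotomicZp.zpExtension 2).layer 2)) / 1296) * θ'' ^ 4 * t'' + ((14987109347 : ↥(ℚ⟮θ⟯ ⊔ (CyclotomicZp.zpExtension 2).layer 2)) / 46656) * θ'' ^ 5 + (-1178790 : ↥(ℚ⟮θ⟯ ⊔ (CyclotomicZp.zpExtension 2).layer 2)) * θ'' ^ 2 * t'' ^ 4 + ((27294013 : ↥(ℚ⟮θ⟯ ⊔ (CyclotomicZp.zpExtension 2).layer 2)) / 8) * θ'' ^ 3 * t'' ^ 3 + ((154538267 : ↥(ℚ⟮θ⟯ ⊔ (CyclotomicZp.zpExtension 2).layer 2)) / 48) * θ'' ^ 4 * t'' ^ 2 + ((2032883 : ↥(ℚ⟮θ⟯ ⊔ (CyclotomicZp.zpExtension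 2).layer 2)) / 288) * θ'' ^ 5 * t'' + ((-185700133 : ↥(ℚ⟮θ⟯ ⊔ (CyclotomicZp.zpExtension 2).layer 2)) / 23328) * θ'' ^ 6 + ((6796529 : ↥(ℚ⟮θ⟯ ⊔ (CyclotomicZp.zpExtension 2).layer 2)) / 8) * θ'' ^ 3 * t'' ^ 4 + ((-2640077 : ↥(ℚ⟮θ⟯ ⊔ (CyclotomicZp.zpExtension 2).layer 2)) / 8) * θ'' ^ 4 * t'' ^ 3 + ((-10731197 : ↥(ℚ⟮θ⟯ ⊔ (CyclotomicZp.zpExtension 2).layer 2)) / 48) * θ'' ^ 5 * t'' ^ 2 + ((-1732063 : ↥(ℚ⟮θ⟯ ⊔ (CyclotomicZp.zpExtension 2).layer 2)) / 432) * θ'' ^ 6 * t'' + ((-469489 : ↥(ℚ⟮θ⟯ ⊔ (CyclotomicZp.zpExtension 2).layer 2)) / 23328) * θ'' ^ 7 + (-235758 : ↥(ℚ⟮θ⟯ ⊔ (CyclotomicZp.zpExtension 2).layer 2)) * θ'' ^ 4 * t'' ^ 4 + ((15995 : ↥(ℚ⟮θ⟯ ⊔ (CyclotomicZp.zpExtension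 2).layer 2)) / 4) * θ'' ^ 5 * t'' ^ 3 + ((204367 : ↥(ℚ⟮θ⟯ ⊔ (CyclotomicZp.zpExtension 2).layer 2)) / 24) * θ'' ^ 6 * t'' ^ 2 + ((567263 : ↥(ℚ⟮θ⟯ ⊔ (CyclotomicZp.zpExtension 2).layer 2)) / 2592) * θ'' ^ 7 * t'' + ((141245 : ↥(ℚ⟮θ⟯ ⊔ (CyclotomicZp.zpExtension 2).layer 2)) / 46656) * θ'' ^ 8 + ((1060215 : ↥(ℚ⟮θ⟯ ⊔ (CyclotomicZp.zpExtension 2).layer 2)) / 32) * θ'' ^ 5 * t'' ^ 4 + ((27975 : ↥(ℚ⟮θ⟯ ⊔ (CyclotomicZp.zpExtension 2).layer 2)) / 16) * θ'' ^ 6 * t'' ^ 3 + ((-12319 : ↥(ℚ⟮θ⟯ ⊔ (CyclotomicZp.zpExtension 2).layer 2)) / 96) * θ'' ^ 7 * t'' ^ 2 + ((-1409 : ↥(ℚ⟮θ⟯ ⊔ (CyclotomicZp.zpExtension 2).layer 2)) / 432) * θ'' ^ 8 * t'' + ((271 : ↥(ℚ⟮θ⟯ ⊔ (CyclotomicZp.zpExtension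 2).layer 2)) / 46656) * θ'' ^ 9 + (-2635 : ↥(ℚ⟮θ⟯ ⊔ (CyclotomicZp.zpExtension 2).layer 2)) * θ'' ^ 6 * t'' ^ 4 + ((-2355 : ↥(ℚ⟮θ⟯ ⊔ (CyclotomicZp.zpExtension 2).layer 2)) / 16) * θ'' ^ 7 * t'' ^ 3 + ((-17 : ↥(ℚ⟮θ⟯ ⊔ (CyclotomicZp.zpExtension 2).layer 2)) / 12) * θ'' ^ 8 * t'' ^ 2 + ((-61 : ↥(ℚ⟮θ⟯ ⊔ (CyclotomicZp.zpExtension 2).layer 2)) / 2592) * θ'' ^ 9 * t'' + ((1935 : ↥(ℚ⟮θ⟯ ⊔ (CyclotomicZp.zpExtension 2).layer 2)) / 16) * θ'' ^ 7 * t'' ^ 4 + ((79 : ↥(ℚ⟮θ⟯ ⊔ (CyclotomicZp.zpExtension 2).layer 2)) / 16) * θ'' ^ 8 * t'' ^ 3 + ((5 : ↥(ℚ⟮θ⟯ ⊔ (CyclotomicZp.zpExtension 2).layer 2)) / 96) * θ'' ^ 9 * t'' ^ 2 + (-3 : ↥(ℚ⟮θ⟯ ⊔ (CyclotomicZp.zpExtension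 2).layer 2)) * θ'' ^ 8 * t'' ^ 4 + ((-1 : ↥(ℚ⟮θ⟯ ⊔ (CyclotomicZp.zpExtension 2).layer 2)) / 16) * θ'' ^ 9 * t'' ^ 3 + ((1 : ↥(ℚ⟮θ⟯ ⊔ (CyclotomicZp.zpExtension 2).layer 2)) / 32) * θ'' ^ 9 * t'' ^ 4) * hθ''rel
  set xB : 𝓞 ↥(ℚ⟮θ⟯ ⊔ (CyclotomicZp.zpExtension 2).layer 2) := ⟨ξ'', hξint⟩ with hxBdef
  have hxBval : algebraMap (𝓞 ↥(ℚ⟮θ⟯ ⊔ (CyclotomicZp.zpExtension 2).layer 2)) ↥(ℚ⟮θ⟯ ⊔ (CyclotomicZp.zpExtension 2).layer 2) xB = ξ'' := rfl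
  have RxB : xB ^ 2 = (gB) * xB + (-30 - 104 * gB + 459 * bB) := by
    apply NumberField.RingOfIntegers.coe_injective
    simp only [map_add, map_sub, map_mul, map_pow, map_zero, map_ofNat, map_neg, map_one, hxBval, hbBval, hgBval]
    rw [hγ''def]
    linear_combination hξsq
  -- `p`
  set p'' : ↥(ℚ⟮θ⟯ ⊔ (CyclotomicZp.zpExtension 2).layer 2) := e'' * ((282 - 74 * θ'' + 4 * θ'' ^ 2) + t'' * (186 - θ'' - θ'' ^ 2)) / 12 with hp''def
  have hpsq : p'' ^ 2 = (3483 : ↥(ℚ⟮θ⟯ ⊔ (CyclotomicZp.zpExtension 2).layer 2)) + ((4917 : ↥(ℚ⟮θ⟯ ⊔ (CyclotomicZp.zpExtension 2).layer 2)) / 2) * t'' + ((-3101 : ↥(ℚ⟮θ⟯ ⊔ (CyclotomicZp.zpExtension 2).layer 2)) / 6) * θ'' + ((-961 : ↥(ℚ⟮θ⟯ ⊔ (CyclotomicZp.zpExtension 2).layer 2)) / 3) * θ'' * t'' + ((115 : ↥(ℚ⟮θ⟯ ⊔ (CyclotomicZp.zpExtension 2).layer 2)) / 6) * θ'' ^ 2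 + ((61 : ↥(ℚ⟮θ⟯ ⊔ (CyclotomicZp.zpExtension 2).layer 2)) / 6) * θ'' ^ 2 * t'' := by
    rw [hp''def]
    linear_combination (((2209 : ↥(ℚ⟮θ⟯ ⊔ (CyclotomicZp.zpExtension 2).layer 2)) / 4) + ((1457 : ↥(ℚ⟮θ⟯ ⊔ (CyclotomicZp.zpExtension 2).layer 2)) / 2) * t'' + ((-1739 : ↥(ℚ⟮θ⟯ ⊔ (CyclotomicZp.zpExtension 2).layer 2)) / 6) * θ'' + ((961 : ↥(ℚ⟮θ⟯ ⊔ (CyclotomicZp.zpExtension 2).layer 2)) / 4) * t'' ^ 2 + ((-2341 : ↥(ℚ⟮θ⟯ ⊔ (CyclotomicZp.zpExtension 2).layer 2)) / 12) * θ'' * t'' + ((1933 : ↥(ℚ⟮θ⟯ ⊔ (CyclotomicZp.zpExtension 2).layer 2)) / 36) * θ'' ^ 2 + ((-31 : ↥(ℚ⟮θ⟯ ⊔ (CyclotomicZp.zpExtension 2).layer 2)) / 12) * θ'' * t'' ^ 2 + ((67 : ↥(ℚ⟮θ⟯ ⊔ (CyclotomicZp.zpExtension 2).layer 2)) / 9)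 * θ'' ^ 2 * t'' + ((-37 : ↥(ℚ⟮θ⟯ ⊔ (CyclotomicZp.zpExtension 2).layer 2)) / 9) * θ'' ^ 3 + ((-371 : ↥(ℚ⟮θ⟯ ⊔ (CyclotomicZp.zpExtension 2).layer 2)) / 144) * θ'' ^ 2 * t'' ^ 2 + ((35 : ↥(ℚ⟮θ⟯ ⊔ (CyclotomicZp.zpExtension 2).layer 2)) / 36) * θ'' ^ 3 * t'' + ((1 : ↥(ℚ⟮θ⟯ ⊔ (CyclotomicZp.zpExtension 2).layer 2)) / 9) * θ'' ^ 4 + ((1 : ↥(ℚ⟮θ⟯ ⊔ (CyclotomicZp.zpExtension 2).layer 2)) / 72) * θ'' ^ 3 * t'' ^ 2 + ((-1 : ↥(ℚ⟮θ⟯ ⊔ (CyclotomicZp.zpExtension 2).layer 2)) / 18) * θ'' ^ 4 * t'' + ((1 : ↥(ℚ⟮θ⟯ ⊔ (CyclotomicZp.zpExtension 2).layer 2)) / 144) * θ'' ^ 4 * t'' ^ 2) * he''2 + ((1209 : ↥(ℚ⟮θ⟯ ⊔ (CyclotomicZp.zpExtension 2).layer 2)) + ((961 : ↥(ℚ⟮θ⟯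 ⊔ (CyclotomicZp.zpExtension 2).layer 2)) / 4) * t'' + ((-801 : ↥(ℚ⟮θ⟯ ⊔ (CyclotomicZp.zpExtension 2).layer 2)) / 4) * θ'' + ((-31 : ↥(ℚ⟮θ⟯ ⊔ (CyclotomicZp.zpExtension 2).layer 2)) / 12) * θ'' * t'' + ((55 : ↥(ℚ⟮θ⟯ ⊔ (CyclotomicZp.zpExtension 2).layer 2)) / 24) * θ'' ^ 2 + ((-371 : ↥(ℚ⟮θ⟯ ⊔ (CyclotomicZp.zpExtension 2).layer 2)) / 144) * θ'' ^ 2 * t'' + (1 : ↥(ℚ⟮θ⟯ ⊔ (CyclotomicZp.zpExtension 2).layer 2)) * θ'' ^ 3 + ((1 : ↥(ℚ⟮θ⟯ ⊔ (CyclotomicZp.zpExtension 2).layer 2)) / 72) * θ'' ^ 3 * t'' + ((-1 : ↥(ℚ⟮θ⟯ ⊔ (CyclotomicZp.zpExtension 2).layer 2)) / 24) * θ'' ^ 4 + ((1 : ↥(ℚ⟮θ⟯ ⊔ (CyclotomicZp.zpExtension 2).layer 2)) / 144) * θ'' ^ 4 * t'') * ht''2 + (((-79 : ↥(ℚ⟮θ⟯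 ⊔ (CyclotomicZp.zpExtension 2).layer 2)) / 36) + ((-125 : ↥(ℚ⟮θ⟯ ⊔ (CyclotomicZp.zpExtension 2).layer 2)) / 72) * t'' + ((5 : ↥(ℚ⟮θ⟯ ⊔ (CyclotomicZp.zpExtension 2).layer 2)) / 36) * θ'' + ((1 : ↥(ℚ⟮θ⟯ ⊔ (CyclotomicZp.zpExtension 2).layer 2)) / 72) * θ'' * t'') * hθ''rel
  have hcoeU : algebraMap (𝓞 ↥(ℚ⟮θ⟯ ⊔ (CyclotomicZp.zpExtension 2).layer 2)) ↥(ℚ⟮θ⟯ ⊔ (CyclotomicZp.zpExtension 2).layer 2)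
      (-6199 - 1137 * xB - 25304 * gB + 120502 * bB + 562 * gB * xB - 2580 * bB * xB) =
      (3483 : ↥(ℚ⟮θ⟯ ⊔ (CyclotomicZp.zpExtension 2).layer 2)) + ((4917 : ↥(ℚ⟮θ⟯ ⊔ (CyclotomicZp.zpExtension 2).layer 2)) / 2) * t'' + ((-3101 : ↥(ℚ⟮θ⟯ ⊔ (CyclotomicZp.zpExtension 2).layer 2)) / 6) * θ'' + ((-961 : ↥(ℚ⟮θ⟯ ⊔ (CyclotomicZp.zpExtension 2).layer 2)) / 3) * θ'' * t'' + ((115 : ↥(ℚ⟮θ⟯ ⊔ (CyclotomicZp.zpExtension 2).layer 2)) / 6) * θ'' ^ 2 + ((61 : ↥(ℚ⟮θ⟯ ⊔ (CyclotomicZp.zpExtension 2).layer 2)) / 6) * θ'' ^ 2 * t'' := by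
    simp only [map_add, map_sub, map_mul, map_pow, map_zero, map_ofNat, map_neg, map_one, hbBval, hgBval, hxBval]
    rw [hγ''def, hξ''def]
    linear_combination (((4841 : ↥(ℚ⟮θ⟯ ⊔ (CyclotomicZp.zpExtension 2).layer 2)) / 9) + ((-64 : ↥(ℚ⟮θ⟯ ⊔ (CyclotomicZp.zpExtension 2).layer 2)) / 3) * t'' + ((281 : ↥(ℚ⟮θ⟯ ⊔ (CyclotomicZp.zpExtension 2).layer 2)) / 9) * θ'' + ((-281 : ↥(ℚ⟮θ⟯ ⊔ (CyclotomicZp.zpExtension 2).layer 2)) / 3) * θ'' * t'') * hθ''rel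
  have hpint : IsIntegral ℤ p'' := by
    refine IsIntegral.of_pow two_pos ?_
    rw [hpsq, ← hcoeU]
    exact NumberField.RingOfIntegers.isIntegral_coe _
  set pB : 𝓞 ↥(ℚ⟮θ⟯ ⊔ (CyclotomicZp.zpExtension 2).layer 2) := ⟨p'', hpint⟩ with hpBdef
  have hpBval : algebraMap (𝓞 ↥(ℚ⟮θ⟯ ⊔ (CyclotomicZp.zpExtension 2).layer 2)) ↥(ℚ⟮θ⟯ ⊔ (CyclotomicZp.zpExtension 2).layer 2) pB = p'' := rfl
  have RpB : pB ^ 2 = -6199 - 1137 * xB - 25304 * gB + 120502 * bB + 562 * gB * xB - 2580 * bB * xB := by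
    apply NumberField.RingOfIntegers.coe_injective
    rw [map_pow, hpBval, hcoeU, hpsq]
  refine ⟨bB, gB, xB, pB, hbBval, ?_, ?_, ?_, RbB, RbgB, RgB, RxB, RpB⟩
  · change γ'' = _
    rw [hγ''def, hθ''def]
  · change ξ'' = _
    rw [hξ''def, ht''def, hθ''def]
  · change p'' = _
    rw [hp''def, ht''def, hθ''def]

end Summit.BirchSwinnertonDyer.BirchSwinnertonDyer.Theorems.AddKatoTwo

end
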